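import Summits.AtomisticToContinuum.Crystallization.Theorems.GappedShellCensusCleanLimitsHaveWindowsCleanChartLinks

/-!
# `CleanLimitsHaveWindows` (stmt-AtomisticToContinuum-15932), line `Sketch` — helper for stub K1
# (`stub_cleanChart`): the chart TRANSFER lemma at matching radius `1/5`, part 2 (conclusion)

See part 1 (`…CleanChartLinks`) for the setting.  Here: the parallelogram case `not_36_54` (a pair of
common neighbours across a square at `x` cannot be the far pair at `y` when both links are perfect
matchings) and the transfer lemma `transfer_of_close` itself (equal labels / adjacent labels / links with
an isolated label read off the degrees / perfect-matching links by the parallelogram case, twice).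
-/

noncomputable section

namespace Summit.AtomisticToContinuum.Crystallization.Theorems.CleanHull

open Literature.Geometry.DiscreteGeometry
open Summit.AtomisticToContinuum.Crystallization.Theorems.PalmUnimodularRigidityShellsToBarlowChart

section Charts

variable {S : Set (EuclideanSpace ℝ (Fin 3))} {b : ℝ} {x y : (EuclideanSpace ℝ (Fin 3))} {P P' : Finset (Fin 3 → ℤ)} {A A' : (EuclideanSpace ℝ (Fin 3)) →ₗᵢ[ℝ] (EuclideanSpace ℝ (Fin 3))}
  {nbx nby : (Fin 3 → ℤ) → (EuclideanSpace ℝ (Fin 3))}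

/-- **The parallelogram case.** With perfect-matching links on both sides, a pair of common neighbours
cannot be across a square (`36`) at `x` and far (`54`) at `y`. [folklore] -/
theorem not_36_54 (hb : 0 < b)
    (hP : P = fcc3Int ∨ P = hcpInt)
    (hbijx : Set.BijOn nbx ↑P {z | z ∈ S ∧ (0 < dist x z ∧ dist x z ≤ 28 / 25)})
    (hclx : ∀ t ∈ P, dist (nbx t) (x + (b * (Real.sqrt 18)⁻¹) • A (intVec t)) ≤ b / 5)
    (hbdx : ∀ t ∈ P, ∀ t' ∈ P, ((0 < dist (nbx t) (nbx t') ∧ dist (nbx t) (nbx t') ≤ 28 / 25) ↔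
      sqNormInt (t - t') = 18))
    (hP' : P' = fcc3Int ∨ P' = hcpInt)
    (hbijy : Set.BijOn nby ↑P' {z | z ∈ S ∧ (0 < dist y z ∧ dist y z ≤ 28 / 25)})
    (hcly : ∀ u ∈ P', dist (nby u) (y + (b * (Real.sqrt 18)⁻¹) • A' (intVec u)) ≤ b / 5)
    (hbdy : ∀ u ∈ P', ∀ u' ∈ P', ((0 < dist (nby u) (nby u') ∧ dist (nby u) (nby u') ≤ 28 / 25) ↔
      sqNormInt (u - u') = 18))
    {ty ux t t' u u' : Fin 3 → ℤ} (hty : ty ∈ P) (htyy : nbx ty = y) (hux : ux ∈ P') (huxx : nby ux = x)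
    (hIx : ∀ τ ∈ (Finset.filter (fun τ : Fin 3 → ℤ => sqNormInt (τ - ty) = 18) P), (Finset.filter (fun τ₂ : Fin 3 → ℤ => sqNormInt (τ - τ₂) = 18) (Finset.filter (fun σ : Fin 3 → ℤ => sqNormInt (σ - ty) = 18) P)).card = 1) (hIy : ∀ μ ∈ (Finset.filter (fun τ : Fin 3 → ℤ => sqNormInt (τ - ux) = 18) P'), (Finset.filter (fun τ₂ : Fin 3 → ℤ => sqNormInt (μ - τ₂) = 18) (Finset.filter (fun σ : Fin 3 → ℤ => sqNormInt (σ - ux) = 18) P')).card = 1)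
    (ht : t ∈ (Finset.filter (fun τ : Fin 3 → ℤ => sqNormInt (τ - ty) = 18) P)) (ht' : t' ∈ (Finset.filter (fun τ : Fin 3 → ℤ => sqNormInt (τ - ty) = 18) P)) (hu : u ∈ (Finset.filter (fun τ : Fin 3 → ℤ => sqNormInt (τ - ux) = 18) P')) (hu' : u' ∈ (Finset.filter (fun τ : Fin 3 → ℤ => sqNormInt (τ - ux) = 18) P'))
    (hut : nby u = nbx t) (hut' : nby u' = nbx t')
    (h36 : sqNormInt (t - t') = 36) (h54 : sqNormInt (u - u') = 54) : False := by
  classical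
  have htP : t ∈ P := (Finset.mem_filter.1 ht).1
  have ht'P : t' ∈ P := (Finset.mem_filter.1 ht').1
  have huP : u ∈ P' := (Finset.mem_filter.1 hu).1
  have hu'P : u' ∈ P' := (Finset.mem_filter.1 hu').1
  -- partners at `x`
  obtain ⟨t₁, ht₁⟩ := Finset.card_eq_one.1 (hIx t ht)
  obtain ⟨t₄, ht₄⟩ := Finset.card_eq_one.1 (hIx t' ht')
  have ht₁mem : t₁ ∈ Finset.filter (fun τ₂ : Fin 3 → ℤ => sqNormInt (t - τ₂) = 18) ((Finset.filter (fun τ : Fin 3 → ℤ => sqNormInt (τ - ty) = 18) P)) := by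
    rw [ht₁]; exact Finset.mem_singleton_self _
  have ht₄mem : t₄ ∈ Finset.filter (fun τ₂ : Fin 3 → ℤ => sqNormInt (t' - τ₂) = 18) ((Finset.filter (fun τ : Fin 3 → ℤ => sqNormInt (τ - ty) = 18) P)) := by
    rw [ht₄]; exact Finset.mem_singleton_self _
  obtain ⟨ht₁L, htt₁⟩ := Finset.mem_filter.1 ht₁mem
  obtain ⟨ht₄L, ht't₄⟩ := Finset.mem_filter.1 ht₄mem
  have ht₁P : t₁ ∈ P := (Finset.mem_filter.1 ht₁L).1
  have ht₄P : t₄ ∈ P := (Finset.mem_filter.1 ht₄L).1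
  -- the vector identity at `x`
  have hvx : t - t₁ = t' - t₄ :=
    linkI_vec P hP ty hty hIx t₁ ht₁L t ht t' ht' t₄ ht₄L htt₁ (by rw [sqNormInt_sub_comm]; exact ht't₄) h36
  -- `t₄` is not a neighbour of `t`
  have htt' : t ≠ t' := by
    rintro rfl
    rw [sub_self] at h36
    revert h36; decide
  have htt₄ : sqNormInt (t - t₄) ≠ 18 := by
    intro h
    have : t₄ ∈ Finset.filter (fun τ₂ : Fin 3 → ℤ => sqNormInt (t - τ₂) = 18) ((Finset.filter (fun τ : Fin 3 → ℤ => sqNormInt (τ - ty) = 18) P)) :=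
      Finset.mem_filter.2 ⟨ht₄L, h⟩
    rw [ht₁, Finset.mem_singleton] at this
    subst this
    -- then `t₁` touches both `t` and `t'`: degree ≥ 2
    have h2 : 2 ≤ (Finset.filter (fun τ₂ : Fin 3 → ℤ => sqNormInt (t₄ - τ₂) = 18) (Finset.filter (fun σ : Fin 3 → ℤ => sqNormInt (σ - ty) = 18) P)).card := by
      have hsub : ({t, t'} : Finset (Fin 3 → ℤ)) ⊆
          Finset.filter (fun τ₂ : Fin 3 → ℤ => sqNormInt (t₄ - τ₂) = 18) ((Finset.filter (fun τ : Fin 3 → ℤ => sqNormInt (τ - ty) = 18) P)) := by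
        intro σ hσ
        rcases Finset.mem_insert.1 hσ with rfl | hσ
        · exact Finset.mem_filter.2 ⟨ht, by rw [sqNormInt_sub_comm]; exact htt₁⟩
        · rw [Finset.mem_singleton] at hσ; subst hσ
          exact Finset.mem_filter.2 ⟨ht', by rw [sqNormInt_sub_comm]; exact ht't₄⟩
      have := Finset.card_le_card hsub
      rwa [Finset.card_pair htt'] at this
    rw [hIx t₄ ht₄L] at h2
    omega
  -- corresponding labels at `y`
  obtain ⟨u₁, hu₁P, hu₁t₁, hu₁L'⟩ := exists_corr hbijx hbdx hbijy hbdy hty htyy hux huxx ht₁P (Finset.mem_filter.1 ht₁L).2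
  obtain ⟨u₄, hu₄P, hu₄t₄, hu₄L'⟩ := exists_corr hbijx hbdx hbijy hbdy hty htyy hux huxx ht₄P (Finset.mem_filter.1 ht₄L).2
  have hu₁L : u₁ ∈ (Finset.filter (fun τ : Fin 3 → ℤ => sqNormInt (τ - ux) = 18) P') := Finset.mem_filter.2 ⟨hu₁P, hu₁L'⟩
  have hu₄L : u₄ ∈ (Finset.filter (fun τ : Fin 3 → ℤ => sqNormInt (τ - ux) = 18) P') := Finset.mem_filter.2 ⟨hu₄P, hu₄L'⟩
  have huu₁ : sqNormInt (u - u₁) = 18 := (adj_transfer hbdx hbdy htP ht₁P huP hu₁P hut hu₁t₁).1 htt₁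
  have hu'u₄ : sqNormInt (u' - u₄) = 18 := (adj_transfer hbdx hbdy ht'P ht₄P hu'P hu₄P hut' hu₄t₄).1 ht't₄
  have huu₄ : sqNormInt (u - u₄) ≠ 18 := fun h =>
    htt₄ ((adj_transfer hbdx hbdy htP ht₄P huP hu₄P hut hu₄t₄).2 h)
  have hu₄u : u₄ ≠ u := by
    rintro rfl
    rw [sqNormInt_sub_comm] at hu'u₄
    rw [hu'u₄] at h54
    norm_num at h54
  have hu₄u' : u₄ ≠ u' := by
    rintro rfl
    rw [sub_self] at hu'u₄
    revert hu'u₄; decide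
  have h36y : sqNormInt (u - u₄) = 36 := linkI_36_of_54 P' hP' ux hux hIy u hu u' hu' u₄ hu₄L h54 hu₄u hu₄u' huu₄
  have hvy : u - u₁ = u₄ - u' :=
    linkI_vec P' hP' ux hux hIy u₁ hu₁L u hu u₄ hu₄L u' hu' huu₁ hu'u₄ h36y
  -- geometry
  set R : (Fin 3 → ℤ) → (EuclideanSpace ℝ (Fin 3)) := fun τ => x + (b * (Real.sqrt 18)⁻¹) • A (intVec τ) with hR
  set R' : (Fin 3 → ℤ) → (EuclideanSpace ℝ (Fin 3)) := fun μ => y + (b * (Real.sqrt 18)⁻¹) • A' (intVec μ) with hR'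
  have hclose : ∀ {τ μ : Fin 3 → ℤ}, τ ∈ P → μ ∈ P' → nby μ = nbx τ → ‖R τ - R' μ‖ ≤ 2 / 5 * b := by
    intro τ μ hτ hμ he
    have e1 : dist (nbx τ) (R τ) ≤ b / 5 := hclx τ hτ
    have e2 : dist (nbx τ) (R' μ) ≤ b / 5 := by rw [← he]; exact hcly μ hμ
    rw [← dist_eq_norm]
    calc dist (R τ) (R' μ) ≤ dist (R τ) (nbx τ) + dist (nbx τ) (R' μ) := dist_triangle _ _ _
      _ = dist (nbx τ) (R τ) + dist (nbx τ) (R' μ) := by rw [dist_comm (R τ)]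
      _ ≤ b / 5 + b / 5 := add_le_add e1 e2
      _ = 2 / 5 * b := by ring
  have hU : ‖R t - R t₁‖ = b := norm_ideal_sub hb.le x A htt₁
  have hU' : ‖R' u - R' u₁‖ = b := norm_ideal_sub hb.le y A' huu₁
  have hUeq : R t - R t₁ = R t' - R t₄ := ideal_sub_eq x A hvx
  have hU'eq : R' u - R' u₁ = R' u₄ - R' u' := ideal_sub_eq y A' hvy
  refine parallelogram_obstruction hb hU hU' ?_ ?_
  · have e : (R t - R t₁) - (R' u - R' u₁) = (R t - R' u) - (R t₁ - R' u₁) := by abel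
    rw [e]
    have := norm_sub_le (R t - R' u) (R t₁ - R' u₁)
    linarith [hclose htP huP hut, hclose ht₁P hu₁P hu₁t₁]
  · rw [hUeq, hU'eq]
    have e : (R t' - R t₄) + (R' u₄ - R' u') = (R t' - R' u') - (R t₄ - R' u₄) := by abel
    rw [e]
    have := norm_sub_le (R t' - R' u') (R t₄ - R' u₄)
    linarith [hclose ht'P hu'P hut', hclose ht₄P hu₄P hu₄t₄]

end Charts

/-- **The transfer lemma at matching radius `b/5`.** Across a bond `x ~ y` of `S`, with integer charts
at both ends (pattern `fcc3Int`/`hcpInt`, labelling bijective onto the bonded neighbours, each label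
within `b/5` of its ideal position at the common scale `b`, bonds among neighbours = label pairs at
squared distance `18`), two common neighbours have the same squared label distance in both charts.
[folklore] -/
theorem transfer_of_close {S : Set (EuclideanSpace ℝ (Fin 3))} {b : ℝ} {x y : EuclideanSpace ℝ (Fin 3)}
    {P P' : Finset (Fin 3 → ℤ)}
    {A A' : EuclideanSpace ℝ (Fin 3) →ₗᵢ[ℝ] EuclideanSpace ℝ (Fin 3)}
    {nbx nby : (Fin 3 → ℤ) → EuclideanSpace ℝ (Fin 3)}
    (hb : 0 < b) (hxS : x ∈ S) (hyS : y ∈ S)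
    (hxy : 0 < dist x y ∧ dist x y ≤ 28 / 25)
    (hP : P = fcc3Int ∨ P = hcpInt)
    (hbijx : Set.BijOn nbx ↑P {z | z ∈ S ∧ (0 < dist x z ∧ dist x z ≤ 28 / 25)})
    (hclx : ∀ t ∈ P, dist (nbx t) (x + (b * (Real.sqrt 18)⁻¹) • A (intVec t)) ≤ b / 5)
    (hbdx : ∀ t ∈ P, ∀ t' ∈ P, ((0 < dist (nbx t) (nbx t') ∧ dist (nbx t) (nbx t') ≤ 28 / 25) ↔
      sqNormInt (t - t') = 18))
    (hP' : P' = fcc3Int ∨ P' = hcpInt)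
    (hbijy : Set.BijOn nby ↑P' {z | z ∈ S ∧ (0 < dist y z ∧ dist y z ≤ 28 / 25)})
    (hcly : ∀ u ∈ P', dist (nby u) (y + (b * (Real.sqrt 18)⁻¹) • A' (intVec u)) ≤ b / 5)
    (hbdy : ∀ u ∈ P', ∀ u' ∈ P', ((0 < dist (nby u) (nby u') ∧ dist (nby u) (nby u') ≤ 28 / 25) ↔
      sqNormInt (u - u') = 18))
    {t t' u u' : Fin 3 → ℤ} (ht : t ∈ P) (ht' : t' ∈ P) (hu : u ∈ P') (hu' : u' ∈ P')
    (hut : nby u = nbx t) (hut' : nby u' = nbx t') : sqNormInt (u - u') = sqNormInt (t - t') := by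
  classical
  -- labels of the two centres
  obtain ⟨ty, hty, htyy⟩ := hbijx.surjOn ⟨hyS, hxy⟩
  obtain ⟨ux, hux, huxx⟩ := hbijy.surjOn ⟨hxS, bond_symm hxy⟩
  -- trivial cases: equal labels, adjacent labels
  by_cases htt' : t = t'
  · subst htt'
    have : u = u' := hbijy.injOn hu hu' (by rw [hut, hut'])
    subst this
    rw [sub_self, sub_self]
  have huu' : u ≠ u' := by
    rintro rfl
    exact htt' (hbijx.injOn ht ht' (by rw [← hut, ← hut']))
  have hadj := adj_transfer hbdx hbdy ht ht' hu hu' hut hut'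
  by_cases h18 : sqNormInt (t - t') = 18
  · rw [h18, hadj.1 h18]
  have h18' : sqNormInt (u - u') ≠ 18 := fun h => h18 (hadj.2 h)
  -- both pairs lie in the links of the centre labels
  have hlkx : ∀ {τ μ : Fin 3 → ℤ}, τ ∈ P → μ ∈ P' → nby μ = nbx τ → τ ∈ (Finset.filter (fun τ : Fin 3 → ℤ => sqNormInt (τ - ty) = 18) P) := by
    intro τ μ hτ hμ he
    refine Finset.mem_filter.2 ⟨hτ, (hbdx τ hτ ty hty).1 ?_⟩
    rw [htyy, ← he]
    exact bond_symm (hbijy.mapsTo hμ).2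
  have hlky : ∀ {τ μ : Fin 3 → ℤ}, τ ∈ P → μ ∈ P' → nby μ = nbx τ → μ ∈ (Finset.filter (fun τ : Fin 3 → ℤ => sqNormInt (τ - ux) = 18) P') := by
    intro τ μ hτ hμ he
    refine Finset.mem_filter.2 ⟨hμ, (hbdy μ hμ ux hux).1 ?_⟩
    rw [huxx, he]
    exact bond_symm (hbijx.mapsTo hτ).2
  have htL := hlkx ht hu hut
  have ht'L := hlkx ht' hu' hut'
  have huL := hlky ht hu hut
  have hu'L := hlky ht' hu' hut'
  -- degrees agree
  have hdeg : ∀ {τ μ : Fin 3 → ℤ}, τ ∈ P → μ ∈ P' → nby μ = nbx τ → (Finset.filter (fun τ₂ : Fin 3 → ℤ => sqNormInt (τ - τ₂) = 18) (Finset.filter (fun σ : Fin 3 → ℤ => sqNormInt (σ - ty) = 18) P)).card = (Finset.filter (fun τ₂ : Fin 3 → ℤ => sqNormInt (μ - τ₂) = 18) (Finset.filter (fun σ : Fin 3 → ℤ => sqNormInt (σ - ux) = 18) P')).card :=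
    fun hτ hμ he => deg_transfer hbijx hbdx hbijy hbdy hty htyy hux huxx hτ hμ he
  have hsx := link_spectrum P hP ty hty t htL t' ht'L htt' h18
  have hsy := link_spectrum P' hP' ux hux u huL u' hu'L huu' h18'
  rcases link_dichotomy P hP ty hty with hIx | ⟨τ₀, hτ₀L, hτ₀0⟩
  · -- perfect-matching link at `x`, hence at `y`
    have hIy : ∀ μ ∈ (Finset.filter (fun τ : Fin 3 → ℤ => sqNormInt (τ - ux) = 18) P'), (Finset.filter (fun τ₂ : Fin 3 → ℤ => sqNormInt (μ - τ₂) = 18) (Finset.filter (fun σ : Fin 3 → ℤ => sqNormInt (σ - ux) = 18) P')).card = 1 := by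
      rcases link_dichotomy P' hP' ux hux with h | ⟨μ₀, hμ₀L, hμ₀0⟩
      · exact h
      · exfalso
        obtain ⟨hμ₀P, hμ₀ux⟩ := Finset.mem_filter.1 hμ₀L
        obtain ⟨τ₀, hτ₀P, hτ₀μ₀, hτ₀ty⟩ := exists_corr hbijy hbdy hbijx hbdx hux huxx hty htyy hμ₀P hμ₀ux
        have := hdeg hτ₀P hμ₀P hτ₀μ₀.symm
        rw [hIx τ₀ (Finset.mem_filter.2 ⟨hτ₀P, hτ₀ty⟩), hμ₀0] at this
        exact one_ne_zero this
    have h48x := linkI_ne_48 P hP ty hty hIx t htL t' ht'L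
    have h48y := linkI_ne_48 P' hP' ux hux hIy u huL u' hu'L
    rcases hsx with hx | hx | hx <;> rcases hsy with hy | hy | hy
    · rw [hx, hy]
    · exact (h48y hy).elim
    · exact (not_36_54 hb hP hbijx hclx hbdx hP' hbijy hcly hbdy hty htyy hux huxx hIx hIy htL ht'L huL hu'L
        hut hut' hx hy).elim
    · exact (h48x hx).elim
    · exact (h48x hx).elim
    · exact (h48x hx).elim
    · exact (not_36_54 hb hP' hbijy hcly hbdy hP hbijx hclx hbdx hux huxx hty htyy hIy hIx huL hu'L htL ht'L
        hut.symm hut'.symm hy hx).elim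
    · exact (h48y hy).elim
    · rw [hx, hy]
  · -- a link with an isolated label at `x`, hence at `y`: distances are read off the degrees
    obtain ⟨hτ₀P, hτ₀ty⟩ := Finset.mem_filter.1 hτ₀L
    obtain ⟨μ₀, hμ₀P, hμ₀τ₀, hμ₀ux⟩ := exists_corr hbijx hbdx hbijy hbdy hty htyy hux huxx hτ₀P hτ₀ty
    have hμ₀L : μ₀ ∈ (Finset.filter (fun τ : Fin 3 → ℤ => sqNormInt (τ - ux) = 18) P') := Finset.mem_filter.2 ⟨hμ₀P, hμ₀ux⟩
    have hμ₀0 : (Finset.filter (fun τ₂ : Fin 3 → ℤ => sqNormInt (μ₀ - τ₂) = 18) (Finset.filter (fun σ : Fin 3 → ℤ => sqNormInt (σ - ux) = 18) P')).card = 0 := by rw [← hdeg hτ₀P hμ₀P hμ₀τ₀]; exact hτ₀0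
    have ex := linkII_table P hP ty hty ⟨τ₀, hτ₀L, hτ₀0⟩ t htL t' ht'L htt' h18
    have ey := linkII_table P' hP' ux hux ⟨μ₀, hμ₀L, hμ₀0⟩ u huL u' hu'L huu' h18'
    rw [ex, ey, hdeg ht hu hut, hdeg ht' hu' hut']

end Summit.AtomisticToContinuum.Crystallization.Theorems.CleanHull

end
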